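import Mathlib
import HarnessLib
import HarnessLib.Audit
import Summits.CriticalPhenomena.Statement
import Literature.Probability.Percolation.CardyFormula
import Literature.Probability.Percolation.Crossings
import Literature.MathematicalPhysics.StatisticalMechanics.TensorRGMap
import Literature.Probability.LatticeModels.SixVertexHeightModel
import HarnessLib.Audit.Status.Attr

/-!
Route: CardyTensorRG

DORMANT since 2026-08-26T05:04:58Z (reconciler: no traction for 8.4 d (last activity item-evidence-added at 2026-08-17T19:44:38Z); parked, not closed — `ledger route dormant route-CriticalPhenomena-CardyTensorRG --off` to reactivate) — unstaffed, not closed; items shared with open routes are served there. `ledger route dormant <id> --off` reactivates.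

# Route CardyTensorRG — computer-assisted tensor RG at Delta=-1/2 — the six-vertex orbit of bond
percolation lands on the Gaussian line (LimitExists with rate, Coulomb-gas crossing law on the
exactly blockable domains); Jordan extension and locality pin kappa=6

It suffices to show X_TNR' = PolyominoGaussianLaw: there is ONE exponent a ∈ (0,1) such that for
every POLYOMINO conformal
rectangle R = (Ω; a, b, c, d) — Ω the interior of a finite union of closed δ₀-lattice squares, marks
at δ₀-lattice points, some δ₀ > 0: exactly
the domains a 2×2-blocking tensor RG contracts as finite OPEN networks of bulk, boundary and corner
tensors — the p = 1/2 bond-ℤ² crossing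
probability of Ω_δ from (ab)_δ to (cd)_δ converges, as δ → 0⁺, to I_a(η), η the cross-ratio of R,
I_a(η) = ∫₀^η (s(1−s))^(−a) ds / ∫₀^1 (s(1−s))^(−a) ds
the normalised incomplete beta function — the crossing law of the Gaussian free field / Coulomb gas
at the stiffness fixed by a; Cardy's F is
I_{2/3}. This is what the card tnr-lanford-ice-rule-protection delivers: a certified flow of the
Baxter–Kelland–Wu six-vertex tensor
W(1,1,√3) (Δ = −1/2) of bond percolation into SOME point of the Gaussian fixed line (crux
GaussianSaddleCertificate) plus convergence of the
boundary/corner tensors (crux BoundaryTwistTensors) gives existence + covariance + the Coulomb-gas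
FORM of the limit on that class, with a known
only inside a certified enclosure (DyadicContraction is the RG's first typed output). Two further
cruxes decide the conjunct: the Jordan
extension PolyominoToJordan (a limit law F continuous on (0,1) valid for all polyomino conformal
rectangles is valid for all conformal
rectangles — RSW equicontinuity in the quad + Radó convergence of moduli; known technology,
unwritten for bond-ℤ²) and CardyRigidity (locality
pins a = 2/3; shared with route CardyUniqueLimit). ROUTE-CHOICE SPLIT (rev 6, 2026-08-16, crux-cap
after auto-crux): the former target X_TNR on
ALL conformal rectangles (GaussianLineCrossingLaw) with its LimitExists shadow
RectangleCrossingLimit is the SECOND thesis; it is not re-opened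
(planning paused, no new routes) because it is a sub-case of route CardyUniqueLimit's X_U (∃ f,
every conformal rectangle has limit
f(cross-ratio); GaussianLineCrossingLaw → X_U trivially; CardyRigidity = shared stmt-0746;
LimitExists = stmt-0747); the implication
PolyominoGaussianLaw → PolyominoToJordan → GaussianLineCrossingLaw is proved INSIDE the deciding
theorem instead of being an item.
Lean: `∃ a : ℝ, a ∈ Set.Ioo (0 : ℝ) 1 ∧ ∀ R :
Literature.Probability.RandomPlanarGeometry.ConformalRectangle, (∃ δ₀ : ℝ, 0 < δ₀ ∧ (∃ s : Finset (ℤ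
× ℤ), R.carrier = interior (⋃ p ∈ s, {z : ℂ | δ₀ * (p.1 : ℝ) ≤ z.re ∧ z.re ≤ δ₀ * ((p.1 : ℝ) + 1) ∧
δ₀ * (p.2 : ℝ) ≤ z.im ∧ z.im ≤ δ₀ * ((p.2 : ℝ) + 1)})) ∧ ∀ i, ∃ m n : ℤ, R.pt i = (δ₀ : ℂ) * ((m :
ℂ) + (n : ℂ) * Complex.I)) → R.HasCrossingLimit
(Literature.Probability.Percolation.bondDomainCrossingProb R) (fun η : ℝ => intervalIntegral (fun s
: ℝ => (s * (1 - s)) ^ (-a)) 0 η MeasureTheory.volume / intervalIntegral (fun s : ℝ => (s * (1 - s))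
^ (-a)) 0 1 MeasureTheory.volume)`

## Assembly
Deciding theorem closes (hP : PolyominoGaussianLaw) (hJ : PolyominoToJordan) (hR : CardyRigidity) :
CardyFormulaZ2 — crux-only, checked
sorry-free (planner Sketch.lean + native self-check; axioms propext, Classical.choice, Quot.sound):
from hP obtain a; (s(1−s))^(−a) is
interval-integrable on [0,1] for a < 1 (intervalIntegrable_rpow' on [0,1/2], symmetry s ↦ 1−s), so
I_a is continuous on (0,1)
(continuousOn_primitive_interval'); hJ with F = I_a gives the limit I_a(η) for EVERY conformal
rectangle (the former target); hR gives
EqOn I_a cardyFunction (Ioo 0 1); crossRatio x ∈ (0,1) for uniformizing data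
(crossRatio_mem_Ioo_of_isUniformizing), so the limit is F(η),
i.e. CardyFormulaZ2 R. The item Assembly (restated at rev 6) records the same implication.

Rationale: WHY THIS LINE. Mechanism (card tnr-lanford-ice-rule-protection, corrected here): BaxterKellandWu1976
turns bond percolation on ℤ² at p = 1/2
into the six-vertex model a = b = 1, c = √3 (Δ = −1/2), a bond-dimension-2 tensor network with U(1)
(ice rule) × ℤ₂ (arrow
reversal) × D₄ symmetry, and crossing probabilities into contractions of the same network with
boundary/twist tensors; a
Kennedy–Rychkov RG map (KennedyRychkov2022 = arXiv:2107.11464, KennedyRychkov2023,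
EbelKennedyRychkov2025 = arXiv:2506.03247, arXiv:2408.10312) acts on an infinite-dimensional Hilbert
space 𝒯 of such symmetric tensors, and its expected
fixed set there is the LINE of Gaussian (free-boson, c = 1) tensors, all of whose torus/rectangle
data are known in closed
form and match DuminilCopinKozlowskiLammersManolescu2026 (arXiv:2603.06268, Thm 8: full-plane GFF at
Δ = −1/2, σ² = 3/π —
proved). The ice rule forbids percolation's relevant vortex/watermelon operators (charged sector, x
= 1/3, 5/48-type) and
arrow reversal kills the staggered polarisation, but (planner audit) the arrow-even staggered
"dimerisation"
multiplet of the untwisted c = 1 theory (Luttinger K = 3/4, x = 3/4 < 2) folds to momentum zero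
under 2×2 blocking and is
excluded by no internal symmetry of blocked tensors, so the line must be treated as a Lanford SADDLE
(Lanford1982Feigenbaum,
KochWittwer1986) of the GAUGE-FIXED map — KR/EKR maps are covariant under the orthogonal gauge
group, and 'fixed point',
'centre', 'unstable cone' are meaningful only for s∘𝓡 with s a C¹ gauge section (arXiv:2408.10312
App. 9; repair of T2, rev 4): certify a normally hyperbolic neighbourhood (unstable index ≥ 1,
one-dimensional centre = the line,
contraction elsewhere), basin entry of 𝓡ⁿ(W), and a criticality SELECTOR — orbits leaving along the
unstable cone enter the
trivial basins Kennedy–Rychkov already control rigorously (high-T 2022, low-T 2023), where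
six-vertex height correlations
decay exponentially, contradicting DKLM Thm 8 / RSW — so the orbit lies on the centre-stable
manifold and converges
GEOMETRICALLY to a point T∞ of the line: LimitExists with a rate along the blocking orbit (crux
DyadicContraction), and,
once boundary and corner/twist tensors are shown to converge to free-boson boundary fixed points
(crux BoundaryTwistTensors),
crossing limits of Coulomb-gas form I_a for every POLYOMINO conformal rectangle — the exactly
2^k-blockable open networks —
(crux PolyominoGaussianLaw = the thesis X_TNR'), covariant because a D₄-invariant Gaussian stiffness
tensor is a multiple of the
identity; the passage to ALL conformal rectangles is a separate, RG-free crux (PolyominoToJordan: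
RSW equicontinuity in the quad +
Radó convergence of moduli, for any F continuous on (0,1)).
Imported areas: rigorous tensor-network RG and computer-assisted proofs of hyperbolicity in
infinite-dimensional dynamics;
the Coulomb-gas / free-boson dictionary; DKLM's transfer-matrix theorem as selector. What no other
route of the sub has:
a mechanism for LimitExists (transverse contraction excludes log-periodicity — CardyUniqueLimit
files LimitExists with no
line of attack), and rotation/conformal invariance re-derived from the exact order-4 lattice
symmetry plus IDENTIFICATION
of the fixed set (not DKKMO/Yang–Baxter as in CardyRotToConf/CardyViaSLE6, not discrete
holomorphicity as in
CardyHarmonicInvariants/CardyDiscreteHolo, not isoradial transport as in CardyIsoradial); it reuses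
CardyUniqueLimit.CardyRigidity (LawlerSchrammWerner2001 locality ⇒ κ = 6) for the last step.
ROUTE-CHOICE SPLIT (rev 6,
2026-08-16; crux-cap 8 > 7 after the auto-crux of the underived target): THIS route keeps thesis 1 —
the tensor-RG mechanism up to
the polyomino Gaussian law, plus the Jordan extension and rigidity, with a crux-only deciding
theorem over PolyominoGaussianLaw,
PolyominoToJordan, CardyRigidity; thesis 2 — X_TNR on all conformal rectangles
(GaussianLineCrossingLaw) as a free-standing
hypothesis with the LimitExists shadow RectangleCrossingLimit — is dropped here and NOT re-opened
(planning paused, no new routes):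
it is a sub-case of route CardyUniqueLimit (X_U := ∃ f, all conformal rectangles have limit
f(cross-ratio); GaussianLineCrossingLaw → X_U;
CardyRigidity shared stmt-0746; LimitExists stmt-0747), so nothing attackable is lost. Of the
tensor-side cruxes, T2
GaussianSaddleCertificate is typed (rev 4) and now also carries the existence of the exact
gauge-fixed map (the former informal T1
CriticalTensorRGMap, refuted-misstated on paper by the plain-blocking witness and merged into T2's
∃R per refuters g44-27/g45-26, is
dropped at rev 6); T3 BoundaryTwistTensors is informal pending D2 / the boundary extension of
TensorRGMap.

RANKED CRUXES. (rev 6, after the split; rank 2 is vacant since T1 was merged into T2 — ranks of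
filed items cannot be renumbered, read #3 as the top crux.)
#3 GaussianSaddleCertificate (crux, TYPED since rev 4, repaired after refuted-misstated on paper:
gauge frame, self-contained ∃; TOP CRUX) — ONE ∃ over a GAUGE-FIXED exact RG map R : TensorRGMap 1
(trivial group), in conclusion form of the Lanford saddle certificate: (a) a C¹ injective family γ :
U ⊆ ℝ^d → ℓ²(ℕ⁴) of exact fixed points of R; (b) normal hyperbolicity over ALL of an open N ⊆
domain: every orbit staying in N converges at geometric rate θ < 1 to a point of γ; (c)+(d) for
every c ∈ [√3, √3+ε) the embedded six-vertex tensor W(1,1,c) (entries pinned in the statement) has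
its orbit in the domain, its tail in N, and converges geometrically to γ(pOf c), with c ↦ pOf c
injective (distinct Δ ⇒ distinct Gaussian points — the typed stand-in for 'line'). Since rev 6 it
also carries what the dropped informal T1 CriticalTensorRGMap asked (existence of the exact,
well-defined map along the orbit is the ∃R). [difficulty: open-problem] (why it might fail: no exact
disentangling RG map is known to have Hilbert–Schmidt Gaussian/critical fixed tensors (2408.10312
§5); a C¹ gauge section may fail at degenerate environment spectra along the orbit; the selector
needs the unproved basin ⇒ correlation-decay bridge.) [arXiv:2408.10312, arXiv:2107.11464,
arXiv:2506.03247, KennedyRychkov2023, Lanford1982Feigenbaum, KochWittwer1986, BatesLuZeng1998,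
arXiv:2603.06268, BaxterKellandWu1976]
#4 DyadicContraction (crux) — transverse-hyperbolicity signature, the RG's first typed output
(shadow of T2+T3 for the simplest boundary; not a hypothesis of closes, kept as the route's cheapest
typed kill signal): for every integer-proportioned lattice rectangle [0, m·2^k] × [0, n·2^k] (m, n ≥
1) the p = 1/2 left-right crossing probabilities converge GEOMETRICALLY fast in k — |P_k − L| ≤ C
θ^k with θ < 1 — i.e. LimitExists along the size-doubling (RG blocking) orbit with pure power-law
corrections to scaling. [difficulty: XL] (why it might fail: Requires LimitExists along L = m2^k
(open, Grimmett1999 §11.10) plus pure power-law corrections; a marginally irrelevant symmetric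
direction (log corrections as at q = 4) or log-periodic drift along the marginal tangent breaks the
geometric bound; Ziff's 1/L term is compatible.) [KennedyRychkov2022, arXiv:2506.03247,
Lanford1982Feigenbaum, Ziff1996, Ziff2011, MendelsonNachmiasWatson2014, GrimmettPercolation1999]
#5 BoundaryTwistTensors (crux, informal) — card T3: the BKW boundary/twist dictionary B1 for
crossingProb (verified TRUE for rectangles by refuter rattack-7100: crossingProb half m n =
Z6V_Y(m,n)/2^E' exactly, kit job j004537) plus convergence of boundary and corner tensors to
free-boson boundary fixed points under the boundary extension of R (see TWO-LAYER PLAN; needs the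
rest of D2 and the boundary/corner extension of TensorRGMap). [BaxterKellandWu1976,
arXiv:2603.06268, KennedyRychkov2022]
#6 CardyRigidity (crux) — (shared with CardyUniqueLimit.CardyRigidity, stmt-CriticalPhenomena-0746)
if the bond-ℤ² crossing probabilities of ALL conformal rectangles converge to a function f of the
cross-ratio, then f = cardyFunction on (0,1): locality of percolation forces the exploration limit
to be SLE₆ (card T5; here it pins a = 2/3 on the Gaussian line instead of a stiffness enclosure).
[difficulty: L] (why it might fail: False only if bond-ℤ² limits are conformally invariant with f ≠
F. As a THEOREM: CamiaNewman2007 Thms 2–3 need hitting kernels in admissible non-Jordan domains with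
moving mesh, not only fixed Jordan rectangles (p. 489), so the hypothesis may be too weak as typed.)
[doi:10.1007/s00440-006-0049-7, Schramm2000, LawlerSchrammWerner2001, Werner2007,
KemppainenSmirnov2017]
#8 PolyominoGaussianLaw (crux, TYPED, rev 5; THE THESIS X_TNR' since rev 6; vetted SURVIVES twice,
rattack 14337 / g2) — ONE a ∈ (0,1) such that every POLYOMINO conformal rectangle (interior of a
finite union of closed δ₀-lattice squares, δ₀-lattice marks — verbatim the class of the shared
target CardyPolygonWords/CardyGluingRDE.CardyLatticePolygon, stmt-4781, which implies it with a =
2/3: cardyFunction = I_{2/3}, cardyFunction_eq_incBeta13_div_holds) has bond-ℤ² crossing limit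
I_a(cross-ratio) as δ → 0⁺. [difficulty: open-problem] (why it might fail: existence + Möbius
covariance of bond-ℤ² crossing limits of lattice polygons is open since LPSA 1994 (arXiv:2206.04599
even claims ¬Cardy on ℤ²); reflex corners carry their own corner operators; a could depend on the
polygon.) [Cardy1992, arXiv:math/9401222, SchrammSmirnov2011, BaxterKellandWu1976, arXiv:2603.06268,
doi:10.1016/j.nuclphysb.2012.10.018]
#9 PolyominoToJordan (CRUX since rev 6 — re-badged from support because it is a hypothesis of the
crux-only deciding theorem; TYPED, rev 5; rank 9 is inherited from its support filing, it is the
EASIEST crux, provable with known technology) — for every F continuous on (0,1): crossing limit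
F(cross-ratio) for all polyomino conformal rectangles ⇒ for every conformal rectangle
(Carathéodory/Radó convergence of moduli of lattice-mark Jordan polyomino approximants +
Schramm–Smirnov RSW equicontinuity of bond-ℤ² crossing probabilities in the quad, uniform in the
mesh, near the four marks + continuity of F at the modulus; general-F form of PolygonReduction 4784
/ RectilinearSuffices 5663, which take F = cardyFunction). [difficulty: L] (why it might fail:
unwritten for bond-ℤ² — needs mesh-uniform RSW equicontinuity in the quad at the marks of an
ARBITRARY Jordan boundary and Radó convergence of cross-ratios for lattice-mark polyomino
approximants; F is only continuous on (0,1), so no boundary-value/monotonicity shortcut.)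
[SchrammSmirnov2011, BollobasRiordan2006 Ch. 7 Lemma 14, doi:10.1007/s00440-006-0049-7 §§5–7,
Pommerenke1992 Thm 2.11, GrimmettPercolation1999 §11.7,
lean:Literature.Probability.Percolation.tri_exists_discreteApprox_proof]
SUPPORT. #1 Assembly (restated at rev 6): PolyominoGaussianLaw → PolyominoToJordan → CardyRigidity →
CardyFormulaZ2 (= the deciding theorem; provable now by `fun hP hJ hR => closes hP hJ hR`). #9
RGToPolyominoLaw (support, informal, card T4; filed right after rev 6 to replace RGToCrossingLaw
stmt-7101, whose text named the dropped decls) — GaussianSaddleCertificate ∧ BoundaryTwistTensors →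
DyadicContraction ∧ PolyominoGaussianLaw. DROPPED at rev 6 (split): GaussianLineCrossingLaw
stmt-6694 (former target = thesis 2, a sub-case of CardyUniqueLimit's X_U),
GaussianLawOfPolyominoLaw stmt-14339 (its glue; the 40-line continuity argument now sits inside
closes), RectangleCrossingLimit stmt-6696 (LimitExists shadow of thesis 2; existence for all
conformal rectangles is CardyUniqueLimit.LimitExists stmt-0747), CriticalTensorRGMap stmt-7079
(informal T1, refuted-misstated on paper, merged into T2), RGToCrossingLaw stmt-7101 (informal glue,
superseded by RGToPolyominoLaw).

TWO-LAYER PLAN. Of the tensor-side items, T3 (rank 5, BoundaryTwistTensors) is still informal (needs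
the boundary/corner extension of
TensorRGMap and the rest of D2); T2 (rank 3, GaussianSaddleCertificate) is TYPED since rev 4 as one
∃ over a gauge-fixed exact map in
CONCLUSION form (fixed manifold γ, normal hyperbolicity quantified over all of N, basin entry +
non-exit of the W(1,1,c) orbits, injective limit
parameter) and since rev 6 absorbs T1; the certificate internals — enclosure radii, cone field,
unstable index (census: k = 1, the staggered (a−b)
dimerisation = percolation's thermal direction), the DKLM/RSW selector — are its PROOF, not
conjuncts. Rank 9 support RGToPolyominoLaw (card T4,
informal): T2 ∧ T3 → DyadicContraction ∧ PolyominoGaussianLaw via exact covariance of finite open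
(polyomino) networks; flagged gap (rreview,
g20-25): 2×2 blocking alone does not relate odd multiples m·2^k nor all meshes δ → 0 — needs the
fixed-point property of γ under composite
blockings or a companion 3×3 map converging to the same point of γ, plus RSW equicontinuity in the
marks. Foreseen glued splits:
GaussianSaddleCertificate ⇐ SpectrumEnclosure (γ enclosed near the numerical gauge-fixed Gaussian
tensors + certified splitting at γ) →
ConeFieldInvariance (cone conditions on N ⇒ clause (b)) → BasinEntrySelector (R^{n₀}(W) ∈ N
certified; exits ⇒ Kennedy–Rychkov trivial basin ⇒
exponential decay of arrow/height correlations of the represented measure, contradicting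
DKLM2026_sixVertex_heightFunction_GFF / rsw_half_holds
⇒ clauses (c)(d)); BoundaryTwistTensors ⇐ BKWTwistIdentity (finite combinatorics, provable-now on
SixVertexHeightModel + BKWOrientationExpansion)
→ BoundaryFixedPoint → BoundaryTwistTensors; PolyominoToJordan is proved with lemmas attached by
`--supports` (QuadEquicontinuityZ2: mesh-uniform
RSW continuity of bondDomainCrossingProb in the marks/arcs; RadoCrossRatio: cross-ratios of
lattice-mark Jordan polyomino approximants converge;
no third layer of items). The Jordan-level statement GaussianLineCrossingLaw is no longer an item:
closes derives it internally from
PolyominoGaussianLaw + PolyominoToJordan. Alternative identification kept in reserve: a = 2/(πσ²)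
from the full-plane stiffness σ² = 3/π
(dklmSigma_sq_sqrt_three) instead of CardyRigidity — would make DKLM load-bearing and need a typed
Gaussian identification of γ (closed-form
compactified-boson torus partition functions; not filed).

KILL CRITERIA. (i) The gauge-fixed orbit Rⁿ(W(1,1,√3)) certifiably (or, for closing, convincingly
numerically: U(1)-symmetric Gilt-TNR/loop-TNR with
gauge fixing as in arXiv:2408.10312 App. 9) LEAVES every
neighbourhood of the c = 1 Gaussian tensors — e.g. a nonzero, growing projection on an arrow-even
block-symmetric relevant
direction not attributable to truncation — closes the route `refuted:GaussianSaddleCertificate` (the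
six-vertex arrow
representation is then not where percolation's fixed point lives). (ii) ¬DyadicContraction (or
¬CardyUniqueLimit.LimitExists, stmt-0747) by TWO
distinct cluster points refutes LimitExists and CardyFormulaZ2 itself — report to operator, every
route of the sub dies.
(iii) ¬DyadicContraction by a slower-than-geometric but convergent orbit refutes only the
hyperbolicity claim — pivot T2 to a
marginal (polynomial-rate) certificate. (iv) B1 failing the 3×2 / 4×3 enumeration test is NOT a
kill: re-pose T3 in the
blob/Temperley–Lieb boundary language (bond dimension 4). (v) CardyRigidity refuted ⇒ CardyFormulaZ2
false as typed.
(vi) X_U proved on CardyUniqueLimit moots the conformal-invariance half but not DyadicContraction /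
the rate.
(vii) A proof that NO exact disentangling scheme has Hilbert–Schmidt fixed tensors of Gaussian type
(EKR's hypothesis,
2408.10312 §5, false at w = 1) refutes T2 as typed — pivot: restate over the weighted space
(TensorRGMap w, w existential) or
close `refuted:GaussianSaddleCertificate` if the weighted version dies too. (viii)
¬PolyominoGaussianLaw with polyomino limits EXISTING but
not of the one-exponent form I_a (polygon-dependent a, or a covariant non-beta law) kills T3's
boundary-line identification and the thesis as
typed, not CardyFormulaZ2 — pivot the identification (reserve: DKLM stiffness) or retire; by
NON-existence it is kill (ii). (ix) ¬PolyominoToJordan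
(a continuous F realised as the limit law of all polyomino conformal rectangles but not of some
Jordan one) is not expected — it would contradict
Schramm–Smirnov RSW equicontinuity in the quad — and would kill, with this route, the polygon-class
assemblies PolygonReduction 4784 /
RectilinearSuffices 5663 of CardyPolygonWords, CardyGluingRDE, CardyBoundaryCoulombGas; the
realistic risk is only that it stays unproved (L-sized).

NOT DECOMPOSED YET. Everything inside T1–T3 (choice of disentanglers, the weighted Hilbert–Schmidt
norm, the sector bookkeeping of EKR 2025, the
interval-arithmetic format of the certificate and how it is replayed in Lean — precedent: the
in-tree HHW certificate files
of Literature.Barriers.CriticalPhenomena.RigorousRGSmallParameterHHW*); the exact unstable index of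
the Gaussian line in the
blocked symmetric space (my audit says ≥ 1; the certificate decides); the passage lattice rectangles
→ polyominoes inside T4 and the G02
discretisation bookkeeping; inside PolyominoToJordan (crux since rev 6) the two lemmas
QuadEquicontinuityZ2 / RadoCrossRatio and the
construction of lattice-mark Jordan polyomino approximants of a marked Jordan domain (component of
the union of interior δ₀-squares, cut
points resolved) — `--supports` lemmas, not items; the gauge section s (continuous + discrete gauge
fixing,
2408.10312 App. 9, §9.1) and where along the orbit its C¹-ness can fail; the dimension d of the
fixed manifold (1 iff the
scheme is exactly C₄-covariant, an open practicality per 2408.10312 §5; else 2–3); whether θ in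
DyadicContraction is uniform in (m, n) (expected: θ = max(1/2, 2^{-(x_irr − 2)}) uniformly, C not);
constants nowhere.

CHEAPEST FALSIFIER. Symmetric-sector census at the Δ = −1/2 fixed tensor (pencil + one numerical
run): from the Bethe-ansatz/Coulomb-gas spectrum of
the untwisted six-vertex model (K = 3/4: charged x = 1/3, neutral momentum-π multiplet x = 3/4,
(∂φ)² 2, cos 4φ 3) list the
x < 2 operators that are U(1)-neutral, arrow-even and even under the D₄ of a 2×2 block. By hand
(NOTES.md) the arrow-even half
of the x = 3/4 multiplet survives, so the card's "attracting line" is dead and the route is filed in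
SADDLE form; the saddle
form dies if a U(1)-GILT/loop-TNR run (bond dimension 16–32, a refuter kit job) shows W(1,1,√3) not
approaching a c = 1 tensor
at all (coarse-transfer-matrix central charge drifting from 1 beyond truncation error over 8–12
steps) or an unstable index ≥ 2
with the orbit excited along it. The refuter's sector-resolved check (kit job j004557: XXZ exact
diagonalisation L ≤ 16,
momentum/arrow-parity-resolved dimensions; pending at rev 4) confirms or kills 'k = 1 in the
symmetric sector'. Typed side: Ziff1996/Ziff2011 finite-size data (corrections a₁/L + a₂/L², no
logs) are
consistent with DyadicContraction; a Monte-Carlo of crossingProb at L = 2^k, k ≤ 9, m:n = 2:1 (limit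
≈ 0.176 if Cardy) with
non-geometric successive differences would be the cheap warning sign (not run in this one-shot
seat). For PolyominoGaussianLaw: a
ONE-parameter fit — Monte-Carlo crossing probabilities of two polyominoes of different moduli (2:1
rectangle vs an L-shape)
must fit I_a with ONE a (±0.01 at L = 512); an η-dependent best a kills the form.

NUMBERS. σ² = 2/arccos Δ = 3/π at Δ = −1/2 (arXiv:2603.06268 Thm 8, G = −(2π)⁻¹ log); Luttinger K =
π/(2(π − γ)) = 3/4 at γ = π/3;
untwisted dimensions: charged 1/(4K) = 1/3, staggered neutral K = 3/4, marginal 2, umklapp 4K = 3,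
pinning e^{2πih} 3;
percolation (twisted) x_t = 3K − 1 = 5/4, watermelon 5/48, 1/4, 2/3, 5/4; RG eigenvalues per 2×
blocking 2^{2−x}: 2^{5/4} ≈ 2.38
(arrow-even staggered, the saddle direction), 2^{−1} (cos 4φ), 2^{−2} (T T̄); Cardy a = 2/3,
I_a(1/2) = 1/2 for all a,
Cardy value for aspect ratio 2 ≈ 0.1761; EKR 2025 certified high-T basin: deviation ≤ 0.02 per
sector in N = 63 sectors
(Hilbert–Schmidt), Thm th:stability; EKR 2408.10312 (Ising, Gilt-TNR χ = 30): gauge-fixed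
Hilbert–Schmidt convergence to
δ ≈ 5·10⁻⁵ by shooting, 10⁻⁹ by Newton, non-universal redundant eigenvalues 0.63 / 0.78 vs T T̄
0.25. Items: 9 at open (5 typed); 9 at rev 4 (6 typed: T2); 12 at rev 5 (9 typed: +
PolyominoGaussianLaw, PolyominoToJordan, GaussianLawOfPolyominoLaw), 8 cruxes after the 2026-08-16
auto-crux of the target (over cap ⇒ route-choice);
8 at rev 6 after the split (6 cruxes: 13817, 6695, 7100, 0746, 14337, 14338 — 5 typed; support
RGToPolyominoLaw informal; Assembly typed), deciding
theorem crux-only over 3 of them.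

DEFINITION REQUESTS. D1 SixVertexHeightModel — LANDED (LatticeModels/SixVertexHeightModel.lean:
sixVertexTensor a b c, Δ(1,1,√3) = −1/2, grid networks,
partitionFunction, height model; SixVertexGFF*.lean: DKLM2026_sixVertex_heightFunction_GFF = DKLM
Thm 2.8, dklmSigma_sq_sqrt_three : σ² = 3/π).
D3 TensorRGMap — LANDED (MathematicalPhysics/StatisticalMechanics/TensorRGMap.lean: FourTensor =
ℓ²(ℕ⁴), torusPartition w n T, structure
TensorRGMap w ρ = open domain + map + normalization + exact 2×2 torus covariance (n ≥ 2) +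
ρ-equivariance + ContDiffOn ℝ 1; no construction). T2 instantiates it with
w = 1 and the trivial group and pins the embedding ιW of W(1,1,c) by its entries inside the
statement (legs (left, right,
down, up) = arrow bits (w, e, s, n) via Bool.toNat, zero off {0,1}⁴). STILL WANTED: D2
SixVertexCrossingNetwork (the BKW
identity expressing `crossingProb half m n` / polyomino `discreteCrossingProb` as a ratio / signed
combination of six-vertex partition
functions with explicit boundary and twist tensors of bounded bond dimension — card B1, finite
combinatorics; BKWOrientationExpansion.lean
has the loop-orientation algebra) and the boundary/corner extension of TensorRGMap (3-leg boundary,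
2-leg corner tensors, open polyomino
networks) for T3/T4. In reserve, not filed:
CompactifiedBosonTorusZ (closed-form free-boson torus partition functions) for a typed Gaussian
identification of γ.

Novelty: Searches (2026-08-15): local `lit search` index DOWN all session (searchd connection reset —
flagged); remote cascade:
zbmath "tensor network renormalization group rigorous Ising" (1: KennedyRychkov2022), crossref
"Kennedy Rychkov tensor
renormalization group high temperature fixed point" (8: KR2022, KR2023, EKR PRB 2025
doi:10.1103/y5fk-l98w, EKR PRX 2025
doi:10.1103/y3xz-t2w8, GiulianiMastropietroRychkov2021, …), crossref + zbmath "tensor network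
renormalization six-vertex model
fixed point" (0 relevant), zbmath "rate of convergence Cardy formula crossing probabilities" (2:
MendelsonNachmiasWatson2014,
BinderChayesLei AIHP 2015 = arXiv:1210.1917), zbmath "Gaussian free field six-vertex height function
scaling limit" (3: DKLM
arXiv:2603.06268, Wu 2026 square-ice CLT arXiv:2206.12058, Chen–Xia 2026), `lit galaxy search
"tensor network renormalization"
--star all` (7 panama books incl. Xiang, Density Matrix and Tensor Network Renormalization, CUP
2023; 0 rigorous), `lit read`
of arXiv:2506.03247 §1 (goal statement, Thm th:stability), arXiv:2107.11464 §7 + App. CDL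
(Lanford-style CAP posed as open
problem), arXiv:2603.06268 §2.3–2.4, §3.1–3.2, Thm 8/11, Cor 10; `ledger negatives`; the six Theses
files of the sub;
`ledger idea list` (126 cards, statuses; the card's own Distinguishes-from covers the 93 earlier
ones); barrier catalogue
BARRIER blocks read: EmbeddingModulusUniqueness, RigorousRGSmallParameter,
PositionSpaceRGNonGibbsian, ScaleCovarianceNotMoebius,
BootstrapLatticeB  [refs: 10.1103/y5fk-l98w, 10.1103/y3xz-t2w8, 10.1007/s10955-022-02924-4, 10.1007/s00023-023-01289-y, 1210.1917, 2603.06268, 2206.12058, 2506.03247, 2107.11464, doi:10.1103/y5fk-l98w, doi:10.1103/y3xz-t2w8, doi:10.1007/s10955-022-02924-4, doi:10.1007/s00023-023-01289-y, KennedyRychkov2022, GiulianiMastropietroRychkov2021, MendelsonNachmiasWatson2014, KennedyRychkov2023, EbelKennedyRychkov2025, KochWittwer]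

Barriers (technique_class: computer-assisted-RG, tensor-network, hyperbolic-fixed-point): - technique_class: computer-assisted-RG, tensor-network, hyperbolic-fixed-point
- Literature.Barriers.CriticalPhenomena.EmbeddingModulusUniqueness: applies to the target (conformal
invariance for bond-ℤ²) and is evaded by the barrier's evasion (i): the exact order-4 rotation of ℤ²
⊂ ℂ enters as the D₄-invariance of the tensor space 𝒯 and of 𝓡, the fixed set is identified as
D₄-symmetric GAUSSIAN tensors, and a D₄-invariant stiffness form on ℝ² is a multiple of the
identity, so T∞ is isotropic; for the stretched lattice diag(1,p)ℤ² the same tensor orbit read in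
stretched coordinates yields the anisotropic GFF, i.e. sheared Cardy (DKLM Thm 11's linear map L_θ)
— consistent with, not contradicting, the barrier. DyadicContraction / RectangleCrossingLimit are
existence-only and named as not blocked.
- Literature.Barriers.CriticalPhenomena.RigorousRGSmallParameter: the line is inside the class
"rigorous RG" but has no small parameter; it does not evade the barrier by a theorem — the bet is
Lanford/Koch–Wittwer certification at O(1) coupling, which the barrier's scope caveat (a) leaves
open and which EKR 2025 already practise for the high-T basin (arXiv:2506.03247 Thm th:stability);
honest residual: no CRITICAL tensor fixed point is rigorous for any model yet (crux
CriticalTensorRGMap).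
- Literature.Barriers.CriticalPhenomena.PositionSpaceRGNonGibbsian: not in class — 𝓡 acts on tensors
(partition-function data) and never defines a renormalised Hamiltonian or measure, the distinction

Novelty grade: new-combination — ROUTE REVIEW (refuter rreview cdf7e025, 2026-08-15). VERDICT: keep open, but as filed the route is effectively BLOCKED-ON defs D1 SixVertexHeightModel / D2 SixVertexCrossingNetwork / D3 TensorRGMap: the mechanism (7079 T1, 7099 T2, 7100 T3, 7101 glue) is untyped; provers/refuters can touch only type (refuter refuter-rreview-route-Schanuel-KFunction-cdf7e025-0, 2026-08-15T13:59:33Z; prior: KennedyRychkov2022 doi:10.1007/s10955-022-02924-4, KennedyRychkov2023 doi:10.1007/s00023-023-01289-y, EbelKennedyRychkov2025 arXiv:2506.03247, Lanford1982Feigenbaum; KochWittwer1986, DKLM2026 arXiv:2603.06268, BaxterKellandWu1976, Lawler2005 Prop 6.33 / LSW2001, route-CriticalPhenomena-CardyUniqueLimit (shares 0746 only))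

History (route lifecycle, newest last):
- 2026-08-15T21:28:57Z · rev 4: restated GaussianSaddleCertificate (stmt-CriticalPhenomena-7099) — route-repair: GaussianSaddleCertificate (stmt-CriticalPhenomena-7099) refuted-misstated on paper (rattack-7099: missing gauge frame; refute-pool: dangling refer (planner-rrefute-CriticalPhenomena-CardyTensorR-16cebc07-0)
- 2026-08-16T03:51:01Z · AUTO-CRUX (backfill): GaussianLineCrossingLaw — hypotheses of the deciding theorem that nothing in the route derives are cruxes (operator:999:586464)
- 2026-08-16T04:10:38Z · rev 7: restated Assembly (stmt-CriticalPhenomena-6697) — route-choice split, step 2/3 (step 1 = rev 6 re-badged PolyominoToJordan support→crux as a binder of the new deciding theorem): crux-only deciding theorem close (planner-rchoice-CriticalPhenomena-CardyTensorR-b89135ae-0)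
- 2026-08-16T04:10:38Z · rev 7: dropped GaussianLawOfPolyominoLaw, GaussianLineCrossingLaw, RectangleCrossingLimit, stmt-CriticalPhenomena-7079, stmt-CriticalPhenomena-7101 — route-choice split, step 2/3 (step 1 = rev 6 re-badged PolyominoToJordan support→crux as a binder of the new deciding theorem): crux-only deciding theorem close (planner-rchoice-CriticalPhenomena-CardyTensorR-b89135ae-0)
- 2026-08-26T05:04:58Z · DORMANT — reconciler: no traction for 8.4 d (last activity item-evidence-added at 2026-08-17T19:44:38Z); parked, not closed — `ledger route dormant route-CriticalPhenomen (operator:999:1979292)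

sub-problem: CardyFormulaZ2 · status: dormant · opened planner-plancard-CriticalPhenomena-CardyFormu-43627b30-0 2026-08-15T11:50:32Z · rev 8 · ledger route-CriticalPhenomena-CardyTensorRG
GENERATED by the gate from the ledger (D-0016/17). Provers cite these decls: `theorem foo : Summit.CriticalPhenomena.CardyFormulaZ2.Theses.CardyTensorRG.<Decl> := …` in Summits/CriticalPhenomena/CardyFormulaZ2/Theorems/<Name>.lean.
-/

namespace Summit.CriticalPhenomena.CardyFormulaZ2.Theses.CardyTensorRG

open scoped BigOperators Topology Manifold Classical MeasureTheory ProbabilityTheory Matrix InnerProductSpace ComplexConjugate ContinuousMap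
open Filter Set Function TopologicalSpace MeasureTheory

attribute [summit_statement] _root_.CardyFormulaZ2

-- earlier GaussianSaddleCertificate (stmt-CriticalPhenomena-7099, replaced 2026-08-15T21:28:57Z -> stmt-CriticalPhenomena-13817): retired by None — [crux] GaussianSaddleCertificate (card T2, corrected from "normally attracting line" to a Lanford SADDLE; see route § Why this line and planner NOTES). Computer-assisted statement about the map 𝓡 of CriticalTensorRGMap: (a) [enclosure] there is an invari
/-- item stmt-CriticalPhenomena-13817 · crux · rank 3 · open · by planner
why it might fail: No exact disentangling RG map is known to have Hilbert–Schmidt Gaussian/critical fixed tensors (arXiv:2408.10312 §5); a C¹ gauge section may fail at degenerate environment spectra along the orbit; the selector needs the unproved tensor-basin ⇒ correlation-decay bridge.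
sources: arXiv:2408.10312 (EbelKennedyRychkov2025Rotations: App. 9 gauge fixing, §9.1, §9.3; §5 open problems), arXiv:2107.11464 (KennedyRychkov2022 §2: gauge covariance of J, CDL), arXiv:2506.03247 (EbelKennedyRychkov2025, Thm th:stability; Conclusions), KennedyRychkov2023, Lanford1982Feigenbaum, KochWittwer1986
[crux] GaussianSaddleCertificate (card T2) — REPAIRED after refuted-misstated on paper
(rattack-7099: missing GAUGE frame; refute-pool g44/g45: dangling reference to the ∃-witness of T1).
Now ONE self-contained ∃ over a GAUGE-FIXED, normalised, EXACT (torus-partition-function-preserving)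
Kennedy–Rychkov-type map R : TensorRGMap 1 (trivial group) — intended witness R = s ∘ 𝓡, 𝓡 a 2×2
blocking with disentanglers (arXiv:2107.11464 §2, 2506.03247 §2), s a C¹ local section of the
orthogonal gauge action (arXiv:2408.10312 App. 9: environment-diagonalising O(χ) gauge per charge
block + discrete sign condition); w = 1 (plain Hilbert–Schmidt); no equivariance demanded — stated
in CONCLUSION FORM of a Lanford/Koch–Wittwer saddle certificate: (a) fixed manifold: a C¹ injective
family γ on an open U ⊆ ℝ^d of EXACT fixed points of R.map (the gauge-fixed Gaussian tensors; d = 1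
= the stiffness line iff the scheme is exactly C₄-covariant, else d ≤ 3 since anisotropic Gaussians
are fixed too; d is existential); (b) normal hyperbolicity of γ, quantified over ALL of an open N ⊆
domain: every orbit that stays in N converges to a point of γ at geometric rate θ < 1 (θ = certified
leading NON-gauge cont -/
@[route_item "route-CriticalPhenomena-CardyTensorRG"]
def GaussianSaddleCertificate : Prop :=
  ∃ ιW : ℝ → Literature.MathematicalPhysics.StatisticalMechanics.FourTensor, (∀ c : ℝ, (∀ e n w s : Bool, (ιW c : Literature.MathematicalPhysics.StatisticalMechanics.FourIndex → ℝ) (w.toNat, e.toNat, s.toNat, n.toNat) = Literature.Probability.LatticeModels.SixVertex.sixVertexTensor (1 : ℝ) 1 c e n w s) ∧ ∀ i : Literature.MathematicalPhysics.StatisticalMechanics.FourIndex, (2 ≤ i.1 ∨ 2 ≤ i.2.1 ∨ 2 ≤ i.2.2.1 ∨ 2 ≤ i.2.2.2) → (ιW c : Literature.MathematicalPhysics.StatisticalMechanics.FourIndex → ℝ) i = 0) ∧ ∃ (R : Literature.MathematicalPhysics.StatisticalMechanics.TensorRGMap (fun _ : ℕ => (1 : ℝ)) (Representation.trivial ℝ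 Unit Literature.MathematicalPhysics.StatisticalMechanics.FourTensor)) (d : ℕ) (γ : (Fin d → ℝ) → Literature.MathematicalPhysics.StatisticalMechanics.FourTensor) (U : Set (Fin d → ℝ)) (N : Set Literature.MathematicalPhysics.StatisticalMechanics.FourTensor) (C θ ε : ℝ) (pOf : ℝ → (Fin d → ℝ)), IsOpen U ∧ ContDiffOn ℝ 1 γ U ∧ Set.InjOn γ U ∧ (∀ p ∈ U, γ p ∈ R.domain ∧ R.map (γ p) = γ p) ∧ IsOpen N ∧ N ⊆ R.domain ∧ 0 ≤ θ ∧ θ < 1 ∧ (∀ T ∈ N, (∀ k : ℕ, R.map^[k] T ∈ N) → ∃ p ∈ U, ∀ k : ℕ, ‖R.map^[k] T - γ p‖ ≤ C * θ ^ k) ∧ 0 < ε ∧ Set.InjOn pOf (Set.Ico (Real.sqrt 3) (Real.sqrt 3 + ε)) ∧ ∀ c ∈ Set.Ico (Real.sqrt 3) (Real.sqrt 3 + ε), pOf c ∈ U ∧ γ (pOf c) ∈ N ∧ (∀ k : ℕ, R.map^[k] (ιW c) ∈ R.domain) ∧ ∃ (n₀ : ℕ) (C' : ℝ), (∀ k :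 ℕ, n₀ ≤ k → R.map^[k] (ιW c) ∈ N) ∧ ∀ k : ℕ, ‖R.map^[k] (ιW c) - γ (pOf c)‖ ≤ C' * θ ^ k

/-- item stmt-CriticalPhenomena-6695 · crux · rank 4 · open · by planner
why it might fail: Requires LimitExists along L = m2^k (open, Grimmett1999 §11.10) plus pure power-law corrections; a marginally irrelevant symmetric direction (log corrections as at q = 4) or log-periodic drift along the marginal tangent breaks the geometric bound; Ziff's 1/L term is compatible.
sources: KennedyRychkov2022, arXiv:2506.03247, Lanford1982Feigenbaum, Ziff1996, Ziff2011, MendelsonNachmiasWatson2014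
[crux] transverse-hyperbolicity signature (shadow of card T1+T2 for the simplest boundary): for
every integer-proportioned lattice rectangle [0, m·2^k] × [0, n·2^k] (m, n ≥ 1) the p = 1/2
left-right crossing probabilities converge GEOMETRICALLY fast in k — |P_k − L| ≤ C θ^k with θ < 1 —
i.e. LimitExists along the size-doubling (RG blocking) orbit with pure power-law corrections to
scaling. [difficulty: XL] -/
@[route_item "route-CriticalPhenomena-CardyTensorRG"]
def DyadicContraction : Prop :=
  ∀ m n : ℕ, 1 ≤ m → 1 ≤ n → ∃ L C θ : ℝ, 0 ≤ θ ∧ θ < 1 ∧ ∀ k : ℕ, |Literature.Probability.Percolation.crossingProb Literature.Probability.Percolation.half (m * 2 ^ k) (n * 2 ^ k) - L| ≤ C * θ ^ k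

-- item stmt-CriticalPhenomena-7100 · crux · rank 5 · open · by planner — informal only, no Lean statement yet:
--   [crux] BoundaryTwistTensors (card T3, BoundaryTNR incl. the lattice dictionary B1). (i) [B1, finite
--   combinatorics] for every lattice rectangle [0,m]×[0,n] the p = 1/2 left-right crossing probability
--   `Literature.Probability.Percolation.crossingProb half m n` equals an explicit ratio / signed
--   combination of six-vertex (Δ = −1/2) partition functions of the rectangle with LOCAL boundary
--   tensors (free percolation sides = reflecting loops with the complex Baxter–Kelland–Wu phases
--   e^{±iπ/6·turn}) and twist/flag tensors of bounded bond dimension at the four corners marking which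
--   boundary-touching loop

/-- item stmt-CriticalPhenomena-0746 · crux · rank 6 · open · by planner
why it might fail: False only if bond-ℤ² limits are conformally invariant with f ≠ F. As a THEOREM: CamiaNewman2007 Thms 2–3 need hitting kernels in admissible non-Jordan domains with moving mesh, not only fixed Jordan rectangles (p. 489), so the hypothesis may be too weak as typed.
sources: doi:10.1007/s00440-006-0049-7, Schramm2000, LawlerSchrammWerner2001, Werner2007, KemppainenSmirnov2017
[crux] Cardy rigidity on Z^2: if the bond-Z^2 crossing probabilities of ALL conformal rectangles
converge to a function f of the cross-ratio, then f = cardyFunction on (0,1). Intended proof: with f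
as hitting kernel, Smirnov2001 Thm 2 / CamiaNewman2007 §§5-7 / Werner2007 §4 give convergence of the
exploration path (AB tightness isTightLaws_map_bondInterface, RSW rsw_half) to a conformally
invariant domain-Markov curve = SLE_κ (Schramm2000); percolation locality forces κ = 6
(LawlerSchrammWerner2001 §3, cf. eq_six_of_forall_measureReal_hitsBefore) and
sle_six_measureReal_hitsBefore returns f = F. Vacuous unless X_U holds, but provable
unconditionally. -/
@[route_item "route-CriticalPhenomena-CardyTensorRG", crux]
def CardyRigidity : Prop :=
  ∀ f : ℝ → ℝ, (∀ R : Literature.Probability.RandomPlanarGeometry.ConformalRectangle, R.HasCrossingLimit (Literature.Probability.Percolation.bondDomainCrossingProb R) f) → Set.EqOn f Literature.Probability.RandomPlanarGeometry.cardyFunction (Set.Ioo 0 1)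

/-- item stmt-CriticalPhenomena-14337 · crux · rank 8 · open · by planner
why it might fail: X_TNR on a dense class: needs existence + Möbius covariance of bond-ℤ² crossing limits of lattice polygons (open since LPSA 1994; arXiv:2206.04599 even claims ¬Cardy on ℤ²); reflex corners carry their own corner operators, and a could a priori depend on the polygon.
sources: Cardy1992, arXiv:math/9401222 (LPSA1994 §2 hypotheses, §3.2 numerics), SchrammSmirnov2011, BaxterKellandWu1976, arXiv:2603.06268 (DKLM2026 Thm 8, Cor 10), doi:10.1016/j.nuclphysb.2012.10.018 (Bondesan–Jacobsen–Saleur 2013, corner operators of rectangular amplitudes)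
[crux] PolyominoGaussianLaw — X_TNR on the dense class the tensor RG computes exactly (the
'PolygonalCase' child of the target in the TWO-LAYER PLAN; filed at rev 5 to clear
route.target-unreachable, route-choice option (a)): ONE exponent a ∈ (0,1) such that every POLYOMINO
conformal rectangle R (carrier = interior of a finite union of closed δ₀-lattice squares, marks at
δ₀-lattice points, some δ₀ > 0 — verbatim the class of the shared target
CardyPolygonWords/CardyGluingRDE.CardyLatticePolygon, stmt-CriticalPhenomena-4781) has bond-ℤ²
crossing limit I_a(cross-ratio) as δ → 0⁺ (all δ, not only δ₀·2^(−k)), I_a the normalised symmetric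
incomplete beta function of the target. What RGToCrossingLaw (T4) must deliver from
GaussianSaddleCertificate (T2) + BoundaryTwistTensors (T3): a polyomino at mesh δ₀·2^(−k) is an
exactly 2^k-blockable OPEN network of bulk, boundary (3-leg) and convex/reflex corner (2-leg)
tensors, its crossing probability a BKW ratio of such contractions (B1), and geometric convergence
of all tensors to the Gaussian bulk/boundary fixed points gives the limit along δ₀·2^(−k) and its
Coulomb-gas form; coherence across all δ is the flagged composite-blocking gap (rreview -/
@[route_item "route-CriticalPhenomena-CardyTensorRG", crux]
def PolyominoGaussianLaw : Prop :=
  ∃ a : ℝ, a ∈ Set.Ioo (0 : ℝ) 1 ∧ ∀ R : Literature.Probability.RandomPlanarGeometry.ConformalRectangle, (∃ δ₀ : ℝ, 0 < δ₀ ∧ (∃ s : Finset (ℤ × ℤ), R.carrier = interior (⋃ p ∈ s, {z : ℂ | δ₀ * (p.1 : ℝ) ≤ z.re ∧ z.re ≤ δ₀ * ((p.1 : ℝ) + 1) ∧ δ₀ * (p.2 : ℝ) ≤ z.im ∧ z.im ≤ δ₀ * ((p.2 : ℝ) + 1)})) ∧ ∀ i, ∃ m n : ℤ, R.pt i = (δ₀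 : ℂ) * ((m : ℂ) + (n : ℂ) * Complex.I)) → R.HasCrossingLimit (Literature.Probability.Percolation.bondDomainCrossingProb R) (fun η : ℝ => intervalIntegral (fun s : ℝ => (s * (1 - s)) ^ (-a)) 0 η MeasureTheory.volume / intervalIntegral (fun s : ℝ => (s * (1 - s)) ^ (-a)) 0 1 MeasureTheory.volume)

/-- item stmt-CriticalPhenomena-14338 · crux · rank 9 · closed · proved by Summit.CriticalPhenomena.CardyFormulaZ2.Cruxes.PolyominoToJordan.Birth.PolyominoToJordan_proof @ 76537455c167 (prover) · by planner
why it might fail: Unwritten for bond-ℤ²: needs mesh-uniform RSW equicontinuity of crossing probabilities in the quad at the marks of an ARBITRARY Jordan boundary plus Radó convergence of cross-ratios of lattice-mark polyomino approximants; F is only continuous on (0,1), so no boundary-value or monotonicity shortcut.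
sources: SchrammSmirnov2011, BollobasRiordan2006 (Ch. 7 Lemma 14, (19)), doi:10.1007/s00440-006-0049-7 (CamiaNewman2007 §§5–7), Pommerenke1992 (Thm 2.11 Radó), GrimmettPercolation1999 (§11.7 RSW), lean:Literature.Probability.Percolation.tri_exists_discreteApprox_proof
[support] PolyominoToJordan — quad-continuity extension ('JordanApproximation' of the TWO-LAYER
PLAN; the general-F form of CardyGluingRDE.PolygonReduction stmt-CriticalPhenomena-4784 and
CardyBoundaryCoulombGas.RectilinearSuffices stmt-CriticalPhenomena-5663): for every F : ℝ → ℝ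
continuous on (0,1), if every polyomino conformal rectangle has bond-ℤ² crossing limit
F(cross-ratio) then every conformal rectangle does. Plan (known technology, no RG input):
approximate (Ω; a,b,c,d) with uniformizing datum (φ,x) by polyomino conformal rectangles R_n ⊆ Ω
with δ₀-lattice marks converging as marked quads (Carathéodory kernel convergence + Radó ⇒
uniformizers converge up to the boundary ⇒ crossRatio x_n → crossRatio x; tree:
exists_isUniformizing_holds, crossRatio_eq_of_isUniformizing_holds); the ℤ²-bond analogue of
Bollobás–Riordan Ch. 7 Lemma 14 / Schramm–Smirnov 2011 (RSW comparison near the marks: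
rsw_half_holds, discreteCrossingProb_clusterPt_mem_Ioo_holds; site-𝕋 version proved in tree:
tri_exists_discreteApprox_proof; cf. PivotalEnergyLaw.InnerApproximation) gives |P(R,δ) − P(R_n,δ)|
≤ ε eventually in δ for n ≥ n₀(ε); conclude with the hypothesis on R_n and continuity of F at crossR -/
@[route_item "route-CriticalPhenomena-CardyTensorRG", crux]
def PolyominoToJordan : Prop :=
  ∀ F : ℝ → ℝ, ContinuousOn F (Set.Ioo (0 : ℝ) 1) → (∀ R : Literature.Probability.RandomPlanarGeometry.ConformalRectangle, (∃ δ₀ : ℝ, 0 < δ₀ ∧ (∃ s : Finset (ℤ × ℤ), R.carrier = interior (⋃ p ∈ s, {z : ℂ | δ₀ * (p.1 : ℝ) ≤ z.re ∧ z.re ≤ δ₀ * ((p.1 : ℝ) + 1) ∧ δ₀ * (p.2 : ℝ) ≤ z.im ∧ z.im ≤ δ₀ * ((p.2 : ℝ) + 1)})) ∧ ∀ i, ∃ m n : ℤ, R.pt i = (δ₀ : ℂ) * ((m : ℂ) + (n : ℂ) * Complex.I)) → R.HasCrossingLimit (Literature.Probability.Percolation.bondDomainCrossingProb R) F) → ∀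 R : Literature.Probability.RandomPlanarGeometry.ConformalRectangle, R.HasCrossingLimit (Literature.Probability.Percolation.bondDomainCrossingProb R) F

-- `PolyominoToJordan` holds: proved by `Summit.CriticalPhenomena.CardyFormulaZ2.Cruxes.PolyominoToJordan.Birth.PolyominoToJordan_proof` @ 76537455c167 (its module imports this route file, so no `_holds` link can be stated here).

-- item stmt-CriticalPhenomena-14645 · support · rank 9 · open · by planner — informal only, no Lean statement yet:
--   [support] RGToPolyominoLaw (card T4; glue of the two-layer plan after the route-choice split,
--   replaces RGToCrossingLaw stmt-CriticalPhenomena-7101 whose text named the dropped decls).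
--   GaussianSaddleCertificate ∧ BoundaryTwistTensors → DyadicContraction ∧ PolyominoGaussianLaw. Steps:
--   (1) a polyomino conformal rectangle at mesh δ₀·2^(−k) is an exactly 2^k-blockable OPEN network of
--   bulk, boundary (3-leg) and corner (2-leg) tensors, and its crossing probability is a
--   Baxter–Kelland–Wu ratio / signed combination of such contractions (dictionary B1 of
--   BoundaryTwistTensors; verified for rectangles by

-- earlier Assembly (stmt-CriticalPhenomena-6697, replaced 2026-08-16T04:10:38Z -> stmt-CriticalPhenomena-14629): retired by None — GaussianLineCrossingLaw → CardyRigidity → CardyFormulaZ2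
/-- item stmt-CriticalPhenomena-14629 · assembly · rank 1 · closed · proved by Summit.CriticalPhenomena.CardyFormulaZ2.Theorems.cardyTensorRG_assembly_proof (prover) · by planner
sources: LawlerSchrammWerner2001, Smirnov2001
[assembly] PolyominoGaussianLaw → PolyominoToJordan → CardyRigidity → CardyFormulaZ2 (route-choice
split: the deciding theorem's implication; provable now as fun hP hJ hR => closes hP hJ hR). -/
@[route_item "route-CriticalPhenomena-CardyTensorRG"]
def Assembly : Prop :=
  PolyominoGaussianLaw → PolyominoToJordan → CardyRigidity → CardyFormulaZ2

-- `Assembly` holds: proved by `Summit.CriticalPhenomena.CardyFormulaZ2.Theorems.cardyTensorRG_assembly_proof` (its module imports this route file, so no `_holds` link can be stated here).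

/-! D-0027 §2.1 — DECIDING THEOREM (planner-authored via `route open/edit --closes-file`; by planner-rchoice-CriticalPhenomena-CardyTensorR-b89135ae-0 2026-08-16T04:10:38Z):
its hypotheses are this route's items and its conclusion the sub-problem Statement (glue_lint), and it elaborates with this file. -/

@[closes "route-CriticalPhenomena-CardyTensorRG"] theorem closes (hP : PolyominoGaussianLaw) (hJ : PolyominoToJordan) (hR : CardyRigidity) : _root_.CardyFormulaZ2 := by
  -- D-0027 §2.1 deciding theorem, CRUX-ONLY (route-choice split 2026-08-16): the tensor-RG deliverable
  -- PolyominoGaussianLaw (ONE exponent a ∈ (0,1): every polyomino conformal rectangle has bond-ℤ² crossing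
  -- limit I_a(cross-ratio)) + the Jordan extension PolyominoToJordan (valid for every F continuous on (0,1))
  -- + Cardy rigidity (a limit law of ALL conformal rectangles equals cardyFunction on (0,1)) ⇒ Cardy's formula.
  -- The former target GaussianLineCrossingLaw (X_TNR on all conformal rectangles) is DERIVED inside this
  -- proof (steps 1–3: I_a is continuous on (0,1) because (s(1-s))^(-a) is integrable on [0,1] for a < 1).
  obtain ⟨a, ha, hpoly⟩ := hP
  -- (1) the Coulomb-gas kernel is interval-integrable on [0, 1/2] (rpow singularity of exponent -a > -1) …
  have hhalf : IntervalIntegrable (fun s : ℝ => (s * (1 - s)) ^ (-a)) MeasureTheory.volume 0 (1 / 2) := by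
    have h1 : IntervalIntegrable (fun s : ℝ => s ^ (-a)) MeasureTheory.volume 0 (1 / 2) :=
      intervalIntegral.intervalIntegrable_rpow' (by linarith [ha.2])
    have h2 : ContinuousOn (fun s : ℝ => (1 - s) ^ (-a)) (Set.uIcc 0 (1 / 2)) := by
      refine ContinuousOn.rpow_const (continuousOn_const.sub continuousOn_id) fun s hs => Or.inl ?_
      rw [Set.uIcc_of_le (by norm_num : (0 : ℝ) ≤ 1 / 2)] at hs
      have := hs.2
      intro h
      linarith
    refine (h1.mul_continuousOn h2).congr_uIoo fun s hs => ?_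
    rw [Set.uIoo_of_le (by norm_num : (0 : ℝ) ≤ 1 / 2)] at hs
    simp only
    rw [Real.mul_rpow hs.1.le (by linarith [hs.2])]
  -- … and on [1/2, 1] by the symmetry s ↦ 1 - s, hence on [0, 1]
  have hker : IntervalIntegrable (fun s : ℝ => (s * (1 - s)) ^ (-a)) MeasureTheory.volume 0 1 := by
    refine hhalf.trans ?_
    have h := hhalf.comp_sub_left 1
    have hsym : (fun s : ℝ => ((1 - s) * (1 - (1 - s))) ^ (-a)) = fun s : ℝ => (s * (1 - s)) ^ (-a) := by
      funext s
      rw [sub_sub_cancel, mul_comm]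
    rw [hsym] at h
    norm_num at h
    exact h.symm
  -- (2) so the normalised incomplete beta function I_a is continuous on (0,1)
  have hcont : ContinuousOn (fun η : ℝ => intervalIntegral (fun s : ℝ => (s * (1 - s)) ^ (-a)) 0 η MeasureTheory.volume /
      intervalIntegral (fun s : ℝ => (s * (1 - s)) ^ (-a)) 0 1 MeasureTheory.volume) (Set.Ioo 0 1) := by
    have h := (intervalIntegral.continuousOn_primitive_interval' hker Set.left_mem_uIcc).div_const
      (intervalIntegral (fun s : ℝ => (s * (1 - s)) ^ (-a)) 0 1 MeasureTheory.volume)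
    rw [Set.uIcc_of_le zero_le_one] at h
    exact h.mono Set.Ioo_subset_Icc_self
  -- (3) Jordan extension: EVERY conformal rectangle has crossing limit I_a(cross-ratio) (= GaussianLineCrossingLaw)
  have hall : ∀ R : Literature.Probability.RandomPlanarGeometry.ConformalRectangle,
      R.HasCrossingLimit (Literature.Probability.Percolation.bondDomainCrossingProb R)
        (fun η : ℝ => intervalIntegral (fun s : ℝ => (s * (1 - s)) ^ (-a)) 0 η MeasureTheory.volume /
          intervalIntegral (fun s : ℝ => (s * (1 - s)) ^ (-a)) 0 1 MeasureTheory.volume) :=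
    hJ _ hcont hpoly
  -- (4) rigidity: I_a = cardyFunction on (0,1); cross-ratios of uniformizing data lie in (0,1)
  have hEq := hR _ hall
  show ∀ R : Literature.Probability.RandomPlanarGeometry.ConformalRectangle,
      R.HasCrossingLimit (Literature.Probability.Percolation.bondDomainCrossingProb R)
        Literature.Probability.RandomPlanarGeometry.cardyFunction
  intro R φ x hφ
  have hη : Literature.Probability.RandomPlanarGeometry.crossRatio x ∈ Set.Ioo (0:ℝ) 1 :=
    Literature.Probability.RandomPlanarGeometry.ConformalRectangle.crossRatio_mem_Ioo_of_isUniformizing hφ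
  rw [← hEq hη]
  exact hall R φ x hφ

end Summit.CriticalPhenomena.CardyFormulaZ2.Theses.CardyTensorRG
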